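import Summits.BirchSwinnertonDyer.BirchSwinnertonDyer.Theorems.GoldfeldAllTwistsTwoConverseTwinHalfTraceSevenModEightShimuraTransport
import Summits.BirchSwinnertonDyer.BirchSwinnertonDyer.Theorems.GoldfeldAllTwistsTwoConverseTwinQuarterTraceTorsion
import HarnessLib

set_option linter.dupNamespace false -- namespace `…BirchSwinnertonDyer.BirchSwinnertonDyer…` is the cell's (D-0017 nested layout)
set_option autoImplicit false

/-!
# LINE C3⁺ (PHASE 2), file P2b-1: the GALOIS side of the quarter trace — at `2`-rank two, the automorphisms fixing
# BOTH genus square roots `√−q, √p ∈ K[1]` are exactly the Artin images of the SQUARES `Cl(K)²` (FACT-FREE)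

Cell `bsd-goldfeld`, seat `bsd-goldfeld-s1p-c3x` (gen 7); planner ORDER (ccxxix)/(ccxxxi) «LINE C3⁺, tranche 1», file P2b, first
(mechanically split) half: the pure Galois/group theory; the Heegner sums (quarter-trace identity in `X₀(49)(K[1])`, the conjugation
law `Ψ″ + τΨ″ = #Cl²·T` from ty's FILE D, `τP_χ = −P_χ`) are P2b-2 `…TwinQuarterTraceGenus`. `--supports stmt-BirchSwinnertonDyer-20044`
as a HELPER. Theses-free; theorems only (no definition, no fact binder, no `sorry`); FACT-FREE.

CONTENT. `L/K` finite Galois, `Θ : G ≃* Gal(L/K)` from a commutative group with `[G : G²] = 4` (Artin, `Cl(𝒪_{−8qp})`, file P2f's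
`index_range_sq_classGroup_QO_eq_four_negEightTwoPrimes`), `r_q, r_p ∈ L` with `r_q² = a`, `r_p² = b`, `a, b, ab ∉ K²` (`a = −q`,
`b = p`; §3 for `d_K = −8qp`). Then (`stab_two_sqrt_iff_symm_mem_range_sq`) **`σ r_q = r_q ∧ σ r_p = r_p ⟺ Θ⁻¹σ ∈ G²`** —
the index-`4` analogue of A″'s `algEquiv_apply_sqrt_eq_iff_symm_mem_range_sq`: squares fix square roots (`algEquiv_sq_apply_sqrt`);
conversely the sign homomorphism `σ ↦ (σr_q/r_q, σr_p/r_p) ∈ (ℤ/2)²` is ONTO (elements moving `r_q`, `r_p`, `r_q r_p` exist by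
`exists_algEquiv_apply_sqrt_eq_neg`), so the joint stabiliser has index `4 = [G : G²]` and contains `Θ(G²)`. §2: the
QUARTER-TRACE IDENTITY `4·Σ_{σ fixes both} f σ = Σ f + Σ χ_qχ_p f + Σ χ_q f + Σ χ_p f` for any family `f` in an additive group
(`χ_• = ±1` the two sign characters). §3: `p, −qp ∉ K²` for `d_K = −8qp` (`−q ∉ K²` is P2f's `not_isSquare_neg_q_of_discr_negEightTwoPrimes`).

HONEST FRAMING: finite group / field algebra only; no Heegner point or `L`-value; no case of K12₂″ / twin″ decided; BSD is not proved.

References: D. Cox, *Primes of the form x² + ny²* (2013) §3.B Thm. 3.15, §6.A Thm. 6.1 [Cox2013].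
-/

noncomputable section

open scoped Classical

open WeierstrassCurve Literature.NumberTheory.EllipticCurves

namespace Summit.BirchSwinnertonDyer.BirchSwinnertonDyer.Theorems.GoldfeldGoodTwists

universe u

section TwoRoots

variable {K : Type} [Field K] {L : Type u} [Field L] [Algebra K L] [CharZero L]

/-- The sign `e_r(σ) ∈ ℤ/2` of a `K`-automorphism on a square root `r` of an element of `K` (`0` if fixed, `1` if negated) is
additive: `e_r(στ) = e_r(σ) + e_r(τ)`. [folklore] -/
theorem sqrtSign_mul {r : L} {d : K} (hr : r ^ 2 = algebraMap K L d) (hr0 : r ≠ 0) (σ τ : L ≃ₐ[K] L) :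
    (if (σ * τ) r = r then (0 : ZMod 2) else 1) = (if σ r = r then (0 : ZMod 2) else 1) + (if τ r = r then 0 else 1) := by
  have hne : -r ≠ r := fun h ↦ hr0 (add_self_eq_zero.mp (neg_eq_iff_add_eq_zero.mp h))
  rw [AlgEquiv.mul_apply]
  rcases algEquiv_apply_sqrt_eq_or hr τ with hτ | hτ <;> rcases algEquiv_apply_sqrt_eq_or hr σ with hσ | hσ <;>
    simp only [hτ, hσ, map_neg, if_true, if_neg hne, neg_neg, add_zero, zero_add]
  decide

variable [FiniteDimensional K L] [IsGalois K L]

/-- **The joint stabiliser of two square roots is the image of the squares (index four).** `Θ : G ≃* Gal(L/K)` with `G`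
commutative and `[G : G²] = 4`; `r_q² = a`, `r_p² = b` with `a`, `b`, `ab` non-squares in `K`. Then
`σ r_q = r_q ∧ σ r_p = r_p ⟺ Θ⁻¹σ ∈ G²`. [cite: Cox2013, §3.B Thm. 3.15 and §6.A Thm. 6.1] -/
theorem stab_two_sqrt_iff_symm_mem_range_sq {G : Type*} [CommGroup G] [Finite G] (Θ : G ≃* (L ≃ₐ[K] L))
    (hidx : (powMonoidHom 2 : G →* G).range.index = 4)
    {rq rp : L} {a b : K} (hrq : rq ^ 2 = algebraMap K L a) (hrp : rp ^ 2 = algebraMap K L b)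
    (ha : ¬ IsSquare a) (hb : ¬ IsSquare b) (hab : ¬ IsSquare (a * b)) (σ : L ≃ₐ[K] L) :
    (σ rq = rq ∧ σ rp = rp) ↔ Θ.symm σ ∈ (powMonoidHom 2 : G →* G).range := by
  have hrq0 : rq ≠ 0 := by
    rintro rfl; apply ha; refine ⟨0, (algebraMap K L).injective ?_⟩
    rw [← hrq, map_mul, map_zero, mul_zero, zero_pow two_ne_zero]
  have hrp0 : rp ≠ 0 := by
    rintro rfl; apply hb; refine ⟨0, (algebraMap K L).injective ?_⟩
    rw [← hrp, map_mul, map_zero, mul_zero, zero_pow two_ne_zero]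
  have hneq : -rq ≠ rq := fun h ↦ hrq0 (add_self_eq_zero.mp (neg_eq_iff_add_eq_zero.mp h))
  have hnep : -rp ≠ rp := fun h ↦ hrp0 (add_self_eq_zero.mp (neg_eq_iff_add_eq_zero.mp h))
  -- squares fix both roots
  have hsq : ∀ g : G, g ∈ (powMonoidHom 2 : G →* G).range → (Θ g) rq = rq ∧ (Θ g) rp = rp := by
    rintro g ⟨δ, rfl⟩
    rw [powMonoidHom_apply, map_pow]
    exact ⟨algEquiv_sq_apply_sqrt hrq (Θ δ), algEquiv_sq_apply_sqrt hrp (Θ δ)⟩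
  refine ⟨fun hσ ↦ ?_, fun h ↦ by simpa using hsq _ h⟩
  -- the sign homomorphism `Gal(L/K) → Multiplicative (ZMod 2 × ZMod 2)`
  let e : (L ≃ₐ[K] L) → ZMod 2 × ZMod 2 := fun τ ↦
    ((if τ rq = rq then 0 else 1), (if τ rp = rp then 0 else 1))
  let f : (L ≃ₐ[K] L) →* Multiplicative (ZMod 2 × ZMod 2) :=
    { toFun := fun τ ↦ Multiplicative.ofAdd (e τ)
      map_one' := by simp [e]
      map_mul' := fun τ₁ τ₂ ↦ by
        rw [← ofAdd_add]
        congr 1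
        simp only [e, Prod.mk_add_mk]
        rw [sqrtSign_mul hrq hrq0, sqrtSign_mul hrp hrp0] }
  have hker : ∀ τ : L ≃ₐ[K] L, τ ∈ f.ker ↔ (τ rq = rq ∧ τ rp = rp) := fun τ ↦ by
    rw [MonoidHom.mem_ker]
    change Multiplicative.ofAdd (e τ) = 1 ↔ _
    rw [← ofAdd_zero, Multiplicative.ofAdd.injective.eq_iff]
    simp only [e, Prod.ext_iff, Prod.fst_zero, Prod.snd_zero]
    constructor
    · rintro ⟨h1, h2⟩
      exact ⟨by by_contra h; rw [if_neg h] at h1; exact one_ne_zero h1, by by_contra h; rw [if_neg h] at h2; exact one_ne_zero h2⟩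
    · rintro ⟨h1, h2⟩; simp [h1, h2]
  -- `f` is onto: images of elements moving `rq`, `rp`, `rq rp`
  have hrqp : (rq * rp) ^ 2 = algebraMap K L (a * b) := by rw [mul_pow, hrq, hrp, map_mul]
  obtain ⟨σq, hσq⟩ := exists_algEquiv_apply_sqrt_eq_neg hrq ha
  obtain ⟨σp, hσp⟩ := exists_algEquiv_apply_sqrt_eq_neg hrp hb
  obtain ⟨σm, hσm⟩ := exists_algEquiv_apply_sqrt_eq_neg hrqp hab
  -- `σm` moves exactly one of `rq`, `rp`
  have hσm' : (σm rq = rq ∧ σm rp ≠ rp) ∨ (σm rq ≠ rq ∧ σm rp = rp) := by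
    have hm : σm (rq * rp) = σm rq * σm rp := map_mul σm rq rp
    rcases algEquiv_apply_sqrt_eq_or hrq σm with h1 | h1 <;> rcases algEquiv_apply_sqrt_eq_or hrp σm with h2 | h2
    · exfalso; rw [hm, h1, h2] at hσm
      exact (mul_ne_zero hrq0 hrp0) (add_self_eq_zero.mp (eq_neg_iff_add_eq_zero.mp hσm))
    · left; exact ⟨h1, by rw [h2]; exact hnep⟩
    · right; exact ⟨by rw [h1]; exact hneq, h2⟩
    · exfalso; rw [hm, h1, h2, neg_mul_neg] at hσm
      exact (mul_ne_zero hrq0 hrp0) (add_self_eq_zero.mp (eq_neg_iff_add_eq_zero.mp hσm))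
  have htop : f.range = ⊤ := by
    -- the three generators of `ZMod 2 × ZMod 2` are in the range
    have h10 : Multiplicative.ofAdd ((1 : ZMod 2), (0 : ZMod 2)) ∈ f.range ∨
        Multiplicative.ofAdd ((1 : ZMod 2), (1 : ZMod 2)) ∈ f.range := by
      rcases algEquiv_apply_sqrt_eq_or hrp σq with h | h
      · left; exact ⟨σq, by change Multiplicative.ofAdd (e σq) = _; simp [e, hσq, hneq, h]⟩
      · right; exact ⟨σq, by change Multiplicative.ofAdd (e σq) = _; simp [e, hσq, hneq, h, hnep]⟩
    have h01 : Multiplicative.ofAdd ((0 : ZMod 2), (1 : ZMod 2)) ∈ f.range ∨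
        Multiplicative.ofAdd ((1 : ZMod 2), (1 : ZMod 2)) ∈ f.range := by
      rcases algEquiv_apply_sqrt_eq_or hrq σp with h | h
      · left; exact ⟨σp, by change Multiplicative.ofAdd (e σp) = _; simp [e, hσp, hnep, h]⟩
      · right; exact ⟨σp, by change Multiplicative.ofAdd (e σp) = _; simp [e, hσp, hnep, h, hneq]⟩
    have hmix : Multiplicative.ofAdd ((0 : ZMod 2), (1 : ZMod 2)) ∈ f.range ∨
        Multiplicative.ofAdd ((1 : ZMod 2), (0 : ZMod 2)) ∈ f.range := by
      rcases hσm' with ⟨h1, h2⟩ | ⟨h1, h2⟩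
      · left; refine ⟨σm, ?_⟩; change Multiplicative.ofAdd (e σm) = _
        rcases algEquiv_apply_sqrt_eq_or hrp σm with h | h
        · exact absurd h h2
        · simp [e, h1, h, hnep]
      · right; refine ⟨σm, ?_⟩; change Multiplicative.ofAdd (e σm) = _
        rcases algEquiv_apply_sqrt_eq_or hrq σm with h | h
        · exact absurd h h1
        · simp [e, h2, h, hneq]
    -- close under multiplication: all of `(1,0), (0,1), (1,1)` lie in the range
    have key : Multiplicative.ofAdd ((1 : ZMod 2), (0 : ZMod 2)) ∈ f.range ∧
        Multiplicative.ofAdd ((0 : ZMod 2), (1 : ZMod 2)) ∈ f.range := by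
      have e10 : Multiplicative.ofAdd ((1 : ZMod 2), (0 : ZMod 2)) =
          Multiplicative.ofAdd ((1 : ZMod 2), (1 : ZMod 2)) * Multiplicative.ofAdd ((0 : ZMod 2), (1 : ZMod 2)) := by
        rw [← ofAdd_add]; exact congrArg _ (by decide)
      have e01 : Multiplicative.ofAdd ((0 : ZMod 2), (1 : ZMod 2)) =
          Multiplicative.ofAdd ((1 : ZMod 2), (1 : ZMod 2)) * Multiplicative.ofAdd ((1 : ZMod 2), (0 : ZMod 2)) := by
        rw [← ofAdd_add]; exact congrArg _ (by decide)
      rcases hmix with h01' | h10'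
      · refine ⟨?_, h01'⟩
        rcases h10 with h | h
        · exact h
        · rw [e10]; exact mul_mem h h01'
      · refine ⟨h10', ?_⟩
        rcases h01 with h | h
        · exact h
        · rw [e01]; exact mul_mem h h10'
    rw [eq_top_iff]
    rintro x -
    obtain ⟨⟨x1, x2⟩, rfl⟩ := Multiplicative.ofAdd.surjective x
    have hcases : ∀ z : ZMod 2, z = 0 ∨ z = 1 := by decide
    rcases hcases x1 with rfl | rfl <;> rcases hcases x2 with rfl | rfl
    · exact ⟨1, by rw [map_one]; rfl⟩
    · exact key.2
    · exact key.1
    · rw [show Multiplicative.ofAdd ((1 : ZMod 2), (1 : ZMod 2)) =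
          Multiplicative.ofAdd ((1 : ZMod 2), (0 : ZMod 2)) * Multiplicative.ofAdd ((0 : ZMod 2), (1 : ZMod 2)) by
          rw [← ofAdd_add]; exact congrArg _ (by decide)]
      exact mul_mem key.1 key.2
  -- index of the joint stabiliser = 4 = index of the squares; the squares lie inside; hence equal
  have hkidx : f.ker.index = 4 := by
    rw [Subgroup.index_ker, htop, Subgroup.card_top, Nat.card_eq_fintype_card, Fintype.card_multiplicative,
      Fintype.card_prod, ZMod.card]
  -- the squares, transported by `Θ`, form a subgroup of `ker f` of the same index
  set R : Subgroup (L ≃ₐ[K] L) := ((powMonoidHom 2 : G →* G).range).map Θ.toMonoidHom with hR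
  have hRle : R ≤ f.ker := by
    rintro τ ⟨g, hg, rfl⟩
    exact (hker _).mpr (hsq g hg)
  have hRidx : R.index = 4 := by
    rw [hR, show Θ.toMonoidHom = ((Θ : G ≃* (L ≃ₐ[K] L)) : G →* (L ≃ₐ[K] L)) from rfl, Subgroup.index_map_equiv]
    exact hidx
  have hRK : R = f.ker := by
    refine le_antisymm hRle ?_
    have hfi : R.FiniteIndex := ⟨by rw [hRidx]; norm_num⟩
    have h := Subgroup.relIndex_mul_index hRle
    rw [hkidx, hRidx] at h
    have hrel : R.relIndex f.ker = 1 := by omega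
    exact (Subgroup.relIndex_eq_one.mp hrel)
  have hmem : σ ∈ R := by rw [hRK]; exact (hker σ).mpr hσ
  obtain ⟨g, hg, hgσ⟩ := hmem
  have : Θ.symm σ = g := by rw [← hgσ]; exact Θ.symm_apply_apply g
  rw [this]; exact hg

end TwoRoots

/-! ## §2 The quarter-trace identity -/

section Identity

variable {ι A : Type*} [Fintype ι] [AddCommGroup A]

/-- **The quarter-trace identity** (character combinatorics on `Gal(K[1]/K)` at `2`-rank two): for two `{±1}`-valued signs
`s_q, s_p` on a finite index set and any family `f`, with `χ_q σ = ±1`, `χ_p σ = ±1` and `χ_qp = χ_q χ_p`: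
`4 · Σ_{s_q σ ∧ s_p σ} f σ = Σ f + Σ χ_qp•f + Σ χ_q•f + Σ χ_p•f` (termwise `1 + χ_qχ_p + χ_q + χ_p = (1+χ_q)(1+χ_p)`).
[folklore] -/
theorem quarterTrace_sum_identity (sq sp : ι → Prop) [DecidablePred sq] [DecidablePred sp] (f : ι → A) :
    (4 : ℤ) • ∑ σ, (if sq σ ∧ sp σ then (1 : ℤ) else 0) • f σ =
      ∑ σ, f σ + ∑ σ, ((if sq σ then (1 : ℤ) else -1) * (if sp σ then (1 : ℤ) else -1)) • f σ +
        ∑ σ, (if sq σ then (1 : ℤ) else -1) • f σ + ∑ σ, (if sp σ then (1 : ℤ) else -1) • f σ := by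
  rw [Finset.smul_sum, ← Finset.sum_add_distrib, ← Finset.sum_add_distrib, ← Finset.sum_add_distrib]
  refine Finset.sum_congr rfl fun σ _ ↦ ?_
  by_cases h1 : sq σ <;> by_cases h2 : sp σ <;> simp [h1, h2]
  all_goals abel

end Identity

/-! ## §3 `p, −qp ∉ K²` for `d_K = −8qp` -/

section NonSquares

variable {K : Type} [Field K] [NumberField K]

/-- **`p ∉ K²`** for `K` imaginary quadratic with `d_K = −8qp` (`q, p` primes): `p` is not a rational square and `p·d_K < 0`. [folklore] -/
theorem not_isSquare_p_of_discr_negEightTwoPrimes (hK : IsImaginaryQuadratic K) {q p : ℕ} (hq : q.Prime) (hp : p.Prime)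
    (hdK : NumberField.discr K = -(8 * (q : ℤ) * p)) : ¬ IsSquare (algebraMap ℚ K (p : ℚ)) := by
  intro h
  have hdQ : ((NumberField.discr K : ℤ) : ℚ) = -(8 * (q : ℚ) * p) := by rw [hdK]; push_cast; ring
  have hq0 : (0 : ℚ) < q := by exact_mod_cast hq.pos
  have hp0 : (0 : ℚ) < p := by exact_mod_cast hp.pos
  rcases isSquare_or_of_isSquare_algebraMap_rat hK h with h' | h'
  · exact not_isSquare_prime hp (Rat.isSquare_natCast_iff.mp h')
  · rw [hdQ] at h'; exact not_isSquare_of_neg (by nlinarith [mul_pos hq0 hp0]) h'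

/-- **`−qp ∉ K²`** for `K` imaginary quadratic with `d_K = −8qp`: `−qp < 0` and `−qp·d_K = 2·(2qp)²` is not a rational square.
[folklore] -/
theorem not_isSquare_neg_qp_of_discr_negEightTwoPrimes (hK : IsImaginaryQuadratic K) {q p : ℕ} (hq : q.Prime) (hp : p.Prime)
    (hdK : NumberField.discr K = -(8 * (q : ℤ) * p)) : ¬ IsSquare (algebraMap ℚ K (-(q : ℚ) * p)) := by
  intro h
  have hdQ : ((NumberField.discr K : ℤ) : ℚ) = -(8 * (q : ℚ) * p) := by rw [hdK]; push_cast; ring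
  have hq0 : (0 : ℚ) < q := by exact_mod_cast hq.pos
  have hp0 : (0 : ℚ) < p := by exact_mod_cast hp.pos
  rcases isSquare_or_of_isSquare_algebraMap_rat hK h with h' | h'
  · exact not_isSquare_of_neg (by nlinarith [mul_pos hq0 hp0]) h'
  · rw [hdQ] at h'
    obtain ⟨s, hs⟩ := h'
    have h2 : IsSquare ((2 : ℕ) : ℚ) := ⟨s / (2 * q * p), by
      have : (q : ℚ) ≠ 0 := by exact_mod_cast hq.ne_zero
      have : (p : ℚ) ≠ 0 := by exact_mod_cast hp.ne_zero
      field_simp; push_cast; linear_combination hs⟩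
    exact not_isSquare_prime Nat.prime_two (Rat.isSquare_natCast_iff.mp h2)

end NonSquares

end Summit.BirchSwinnertonDyer.BirchSwinnertonDyer.Theorems.GoldfeldGoodTwists

end
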